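import Summits.AnomalousDissipation.AnomalousDissipation.Theses.CoherentStates

/-!
# `CoherentStates.ClassicalGlobalIsGlobalLerayHopf` (stmt-AnomalousDissipation-0223): proof

`Summit.AnomalousDissipation.AnomalousDissipation.Theses.CoherentStates.ClassicalGlobalIsGlobalLerayHopf`
is the support item #6 of route `AnomalousDissipation/CoherentStates`: for `ν > 0`, a classical
solution `(u, p)` of the forced Navier–Stokes system on all of `ℝ × 𝕋³`
(`Torus.IsClassicalNSSolutionOn univ ν f u p`) with jointly smooth force `f` is a global
Leray–Hopf weak solution with datum `u 0` (`Torus.IsGlobalLerayHopf ν f (u 0) u`).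

The item is, verbatim, the body of the named fact
`Literature.Analysis.FluidPDE.Torus.isGlobalLerayHopf_of_isClassicalNSSolutionOn`
(Robinson–Rodrigo–Sadowski 2016, Thm. 6.5, PDF p. 101; Galdi 2000, Thm. 4.1), which is DISCHARGED
in the tree by `Literature.Analysis.FluidPDE.Torus.isGlobalLerayHopf_of_isClassicalNSSolutionOn_holds`
(module `Literature.Analysis.FluidPDE.TorusClassicalLerayHopfProofs`, imported by the route file),
itself a wrapper of the hypothesis-free dot-lemma
`Literature.Analysis.FunctionSpaces.Torus.IsClassicalNSSolutionOn.isGlobalLerayHopf`. So the proof is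
one line; the hypotheses `0 < ν` and `IsSmoothSpaceTimeOn univ f` are not needed (on the compact
torus every Leray–Hopf clause of a classical solution is automatic). The result is unconditional:
no named fact is taken as a hypothesis.
-/

-- `Summit.<Summit>.<Problem>` is the tree's mandated summit-side namespace (CONVENTIONS §2); for this
-- single-conjunct summit the two coincide, so the duplicate is deliberate.
set_option linter.dupNamespace false

namespace Summit.AnomalousDissipation.AnomalousDissipation.Theorems

/-- **Support item #6 of route `CoherentStates`** (stmt-AnomalousDissipation-0223): a classical
solution of NS_ν (`ν > 0`) on all of `ℝ × 𝕋³` with space-time smooth force is a global Leray–Hopf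
solution from `u 0`. One line from the discharged Literature fact
`Literature.Analysis.FluidPDE.Torus.isGlobalLerayHopf_of_isClassicalNSSolutionOn_holds`
(Robinson–Rodrigo–Sadowski 2016 Thm. 6.5; Galdi 2000 Thm. 4.1); unconditional.
[route AnomalousDissipation/CoherentStates; folklore bookkeeping] -/
theorem classicalGlobalIsGlobalLerayHopf_proof :
    Summit.AnomalousDissipation.AnomalousDissipation.Theses.CoherentStates.ClassicalGlobalIsGlobalLerayHopf := by
  unfold Summit.AnomalousDissipation.AnomalousDissipation.Theses.CoherentStates.ClassicalGlobalIsGlobalLerayHopf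
  exact Literature.Analysis.FluidPDE.Torus.isGlobalLerayHopf_of_isClassicalNSSolutionOn_holds

end Summit.AnomalousDissipation.AnomalousDissipation.Theorems
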